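import Summits.AtomisticToContinuum.Crystallization.Theses.SquareWellLayerCake
import Summits.AtomisticToContinuum.Crystallization.Theses.PalmUnimodularRigidity
import Summits.AtomisticToContinuum.Crystallization.Theorems.PalmUnimodularRigidityCruxesToPalmRigidity
import Summits.AtomisticToContinuum.Crystallization.Theorems.PalmUnimodularRigidityShellsToBarlowChart
import Summits.AtomisticToContinuum.Crystallization.Theorems.PalmUnimodularRigidityLayeredLawsSelectHcpDefs
import Summits.AtomisticToContinuum.Crystallization.Theorems.ExcessDecayLiouvilleCoarseGrainsHcpEnergySeries
import Summits.AtomisticToContinuum.Crystallization.Theorems.PalmUnimodularRigidityCrysPeriodicBddBelow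
import Summits.AtomisticToContinuum.Crystallization.Theorems.SquareWellLayerCakeTwelveWithinOneBsLimitAlong
import Summits.AtomisticToContinuum.Crystallization.Theorems.SquareWellLayerCakeTwelveWithinOneHcpRootGeometry
import Summits.AtomisticToContinuum.Crystallization.Theorems.SquareWellLayerCakeTwelveWithinOneReturn
import Summits.AtomisticToContinuum.Crystallization.Theorems.SquareWellLayerCakeTwelveWithinOneHcpCellCertificate

/-!
# Line `Sketch` (reshaped by the lead) — checked skeleton for crux `TwelveWithinOne`
(item stmt-AtomisticToContinuum-15808, route `SquareWellLayerCake`, K2, rank 4)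

Crux (by name, `SquareWellLayerCake.TwelveWithinOne`): for every sequence of Lennard-Jones ground states
`x^N ⊂ ℝ³` the fraction of particles `i` failing
[every particle within `11/10` of `x_i` (itself included) is `55/57`-separated from all others ∧ at
least twelve particles `j ≠ i` with `dist (x_i, x_j) ≤ 1`] tends to `0`.

## The line (ideator-2 card `Ideas/palm-limit-exact-pinning.md`, reshaped — see `PICKED.md`)

K2's absolute constants (`[55/57, 1] = [0.96491, 1]`, shells `1` and `11/10`) are a `0.65 % / 2.9 %`
neighbourhood of the zero-stress LJ close packing (relaxed hcp: `a* = 0.971297`, interlayer bond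
`0.971206`, next distance `≥ 1.37`). So K2 = [scale-free local crystallinity of minimisers] + [the lattice
constant]. Pass to the Benjamini–Schramm limit law `P` of the ground states ALONG AN ARBITRARY SUBSEQUENCE
(`stub_bsLimitAlong`, the construction of item 9230 verbatim with a prescribed subsequence — needed because
the crux is a full `Tendsto`); `P` is a minimising point-stationary hard-core law (`E_P[h] = lim E(N)/N = e*`,
`crysEnergyLimit_proof`). The deepest landed chain of the sub-problem then applies BY NAME:
`MinimiserShells` (item 9225, OPEN, = `stub_minimiserShells`) → `ShellsToBarlowChart` (9227, LANDED
`ShellsToBarlowChart_of`) → `LayeredLawsSelectHcp` (9226, OPEN, = `stub_layeredLawsSelectHcp`) →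
`PalmRigidity` (landed glue `cruxesToPalmRigidity_proof`): `P`-a.s. the rooted configuration is
`count|A(hcpStacking a h)` with `e(hcp a h) = e*`. Since `e* ≤ e(hcp a' h')` for every `a', h'`
(`ciInf_le crysPeriodicBddBelow_proof`) and `e(hcp a h) = hcpE a h` (`hcpEnergySeries_of_eq`), the pair
`(a, h)` is a GLOBAL MINIMISER of the explicit lattice-sum function `hcpE` — the lattice constant is pinned
with NO conditioning, NO floor, NO Markov residual. A two-variable certified computation
(`stub_hcpCellCertificate`: every global minimiser of `hcpE` has `a` and `√(a²/3+h²)` in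
`[55/57 + σ, 1 − σ]` for some `σ > 0`; float margin `5.8·10⁻⁴` per particle at the binding exit
`b → 55/57`, `compute/hcp_margin.py`; method = the landed kernel evaluator `hcpSumFloorSum` /
`hcpSumS_ge_cert` / `hcpSumS_le_cert` of `ExcessDecayLiouvilleCoarseGrainsPin*` on a finer grid) and pure
hcp geometry (`stub_hcpRootGeometry`: twelve neighbours at `a` and `√(a²/3+h²) ≤ 1 − σ`, all other
distances of the stacking `≥ min (a, √(a²/3+h²)) ≥ 55/57 + σ`) give K2's predicate WITH INWARD SLACK `σ` at
the root of `P`-a.e. configuration; the density-transfer (portmanteau) clause of the BS limit returns it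
to all but `o(N)` particles along the subsequence, the slack absorbing the matching tolerance, and
"every subsequence has a sub-subsequence" gives the `Tendsto` (`stub_return`).

WHY THE RESHAPE (lead, cycle 1). The card's selection-free stub `stub_tubeRigidity` ("a minimising law
carried by everywhere-good Barlow-charted configurations is a.s. an EXACT `A(barlowStacking a h s)`") is not
provable without selection: relaxed non-hcp polytypes (6H = hcc, 9R = hhc, …) have NON-UNIFORM layer
spacings (h–h, h–c, c–c layer pairs relax differently), so they are not `barlowStacking a h s` for any
uniform `h`; asserting uniform exactness for minimising laws therefore EXCLUDES those words energetically,
which is a selection statement at the `|J₃| ~ 10⁻⁶` level — harder than 9226's own. Taking 9226 by name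
(staffed; its line has landed ≈ 24 files and isolated two `e*`-free cores) is the honest dependency, and
it makes the card's `stub_pinning` FREE (global minimality of `hcpE` replaces invariant conditioning +
9229 + floor). Net: K2 closes the day 9225 ∧ 9226 close, plus ONE certified two-variable computation.
(Under 9225 ∧ 9226 the whole sub-problem closes through `PalmUnimodularRigidity.closes`; K2 remains a
theorem about coordination of minimisers and the item closes — planners decide what that means for route
SquareWellLayerCake; said in the release note, D-0014.)

Registered stubs (`stub_*`; after cycle 1 the ONLY `sorry`s left are the two shared open cruxes 9225/9226 — every other stub
is a one-line alias of its landed Theorems lemma; the same composition WITHOUT sorries, as the conditional theorem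
`twelveWithinOne_of_palmCruxes : MinimiserShells → LayeredLawsSelectHcp → TwelveWithinOne`, is
`Theorems/SquareWellLayerCakeTwelveWithinOne.lean`):
* `stub_minimiserShells`   (= item stmt-AtomisticToContinuum-9225, shared crux, OPEN; discharged by
                              `MinimiserShells_holds` the day it lands)
* `stub_layeredLawsSelectHcp` (= item stmt-AtomisticToContinuum-9226, shared crux, OPEN; idem)
* `stub_bsLimitAlong`      (M, LANDED p129041 `…TwelveWithinOneBsLimitAlong`) — 9230 along a prescribed subsequence (adapt `BenjaminiSchrammLimit.exists_limit`:
                              `CompactSpace.tendsto_subseq (Qs ∘ ψ)`).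
* `stub_hcpCellCertificate` (L, certified numerics, LANDED p130069 `…TwelveWithinOneHcpCellCertificate` with its
                              helpers p129430 `…CertKernel`, p129563 `…CertShape`, p130047 `…CertGrid`) — global minimisers of `hcpE` lie in K2's bond box with
                              slack.
* `stub_hcpRootGeometry`   (S/M, LANDED p129182 `…TwelveWithinOneHcpRootGeometry`) — K2-with-slack at the root of `count|A(hcpStacking a h)`.
* `stub_return`            (M, LANDED p129390 `…TwelveWithinOneReturn`) — measure-level K2 with slack + BS limit along subsequences ⇒ the crux.
Composition `TwelveWithinOne_of : TwelveWithinOne` BY NAME, `sorry`-free outside the stubs.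
-/

noncomputable section

open MeasureTheory Filter Set
open scoped ENNReal Topology

namespace Summit.AtomisticToContinuum.Crystallization.Cruxes.TwelveWithinOne.Sketch

open Literature.MathematicalPhysics.StatisticalMechanics
open Summit.AtomisticToContinuum.Crystallization.Theses.PalmUnimodularRigidity
  (MinimiserShells LayeredLawsSelectHcp PalmRigidity ShellsToBarlowChart)
open Summit.AtomisticToContinuum.Crystallization.Theorems.PalmUnimodularRigidity.LayeredLawsSelectHcp (hcpE hcpQ)
open Summit.AtomisticToContinuum.Crystallization.Theorems.ExcessDecayLiouvilleCoarseGrains (hcpEnergySeries_of_eq)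

/-! ## Vocabulary (abbreviations used by the composition; every stub is stated with them UNFOLDED) -/

/-- **K2 with inward slack `σ` at the root** of a configuration measure `μ`: every atom `w` with
`‖w‖ ≤ 11/10 + σ` is `(55/57 + σ)`-separated from all other atoms, and there are twelve atoms `w ≠ 0` with
`‖w‖ ≤ 1 − σ`. [folklore] -/
def RootTwelveWithin (σ : ℝ) (μ : Measure (EuclideanSpace ℝ (Fin 3))) : Prop :=
  (∀ w : EuclideanSpace ℝ (Fin 3), μ {w} ≠ 0 → ‖w‖ ≤ 11 / 10 + σ →
      ∀ w' : EuclideanSpace ℝ (Fin 3), μ {w'} ≠ 0 → w' ≠ w → 55 / 57 + σ ≤ dist w w') ∧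
    ∃ T : Finset (EuclideanSpace ℝ (Fin 3)), T.card = 12 ∧
      ∀ w ∈ T, μ {w} ≠ 0 ∧ w ≠ 0 ∧ ‖w‖ ≤ 1 - σ

/-- **Measure-level K2 with slack `σ`**: every minimising point-stationary hard-core probability law on
rooted configurations of `ℝ³` (the four standing hypotheses of route `PalmUnimodularRigidity`, verbatim)
satisfies `RootTwelveWithin σ` almost surely. [folklore] -/
def MinimisingLawsTwelveWithin (σ : ℝ) : Prop :=
  ∀ δ : ℝ, 0 < δ → ∀ P : Measure (Measure (EuclideanSpace ℝ (Fin 3))), IsProbabilityMeasure P →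
    (∀ᵐ μ ∂P, (∃ S : Set (EuclideanSpace ℝ (Fin 3)), (0 : EuclideanSpace ℝ (Fin 3)) ∈ S ∧
      (∀ x ∈ S, ∀ y ∈ S, x ≠ y → δ ≤ dist x y) ∧
      μ = (Measure.count : Measure (EuclideanSpace ℝ (Fin 3))).restrict S)) →
    (∀ g : Measure (EuclideanSpace ℝ (Fin 3)) → EuclideanSpace ℝ (Fin 3) → ℝ≥0∞,
      Measurable (Function.uncurry g) →
      ∫⁻ μ, ∫⁻ y, g μ y ∂μ ∂P = ∫⁻ μ, ∫⁻ y, g (Measure.map (fun z => z - y) μ) (-y) ∂μ ∂P) →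
    (∫ μ, (∫ y, lennardJones ‖y‖ ∂μ) / 2 ∂P) ≤
      (⨅ Q : PeriodicConfiguration 3, Q.energyPerParticle lennardJones) →
    ∀ᵐ μ ∂P, RootTwelveWithin σ μ

/-! ## The registered stubs -/

/-- **STUB (= item stmt-AtomisticToContinuum-9225, shared crux `MinimiserShells`, OPEN)**: measure-level local
structure of minimising point-stationary hard-core laws (close-packed root shell a.s.). Not attacked by
this line; discharged by `MinimiserShells_holds` when the crux lands. -/
theorem stub_minimiserShells : MinimiserShells := by
  sorry

/-- **STUB (= item stmt-AtomisticToContinuum-9226, shared crux `LayeredLawsSelectHcp`, OPEN)**: selection and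
rigidity in density form (its line `mtp-prestress-split-ergodic-frame` has isolated two `e*`-free cores,
`stub_selectionFloor` and `stub_hcpTubeRigidity`). Not attacked by this line; discharged by
`LayeredLawsSelectHcp_holds` when the crux lands. -/
theorem stub_layeredLawsSelectHcp : LayeredLawsSelectHcp := by
  sorry

/-- **STUB `stub_bsLimitAlong` (M)** — the Benjamini–Schramm limit of Lennard-Jones ground states along a
PRESCRIBED subsequence `ψ`: a further subsequence `ψ ∘ φ`, a hard core `δ > 0` and a probability law `P`
on rooted `δ`-separated counting measures which is point-stationary (Mecke identity), has mean root energy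
`lim_j E(ψ φ j)/(ψ φ j)`, and is the local limit of the uniformly re-rooted `x^(ψ φ j)` in density-transfer
form. Proof = `BenjaminiSchrammLimit.exists_limit` verbatim with `Qs ∘ ψ` in `CompactSpace.tendsto_subseq`.
[folklore] -/
theorem stub_bsLimitAlong :
    ∀ x : (N : ℕ) → (Fin N → EuclideanSpace ℝ (Fin 3)), (∀ N, IsGroundState lennardJones (x N)) →
    ∀ ψ : ℕ → ℕ, StrictMono ψ →
    ∃ φ : ℕ → ℕ, StrictMono φ ∧ ∃ δ : ℝ, 0 < δ ∧
      ∃ P : Measure (Measure (EuclideanSpace ℝ (Fin 3))), IsProbabilityMeasure P ∧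
      (∀ᵐ μ ∂P, (∃ S : Set (EuclideanSpace ℝ (Fin 3)), (0 : EuclideanSpace ℝ (Fin 3)) ∈ S ∧
        (∀ x ∈ S, ∀ y ∈ S, x ≠ y → δ ≤ dist x y) ∧
        μ = (Measure.count : Measure (EuclideanSpace ℝ (Fin 3))).restrict S)) ∧
      (∀ g : Measure (EuclideanSpace ℝ (Fin 3)) → EuclideanSpace ℝ (Fin 3) → ℝ≥0∞,
        Measurable (Function.uncurry g) →
        ∫⁻ μ, ∫⁻ y, g μ y ∂μ ∂P = ∫⁻ μ, ∫⁻ y, g (Measure.map (fun z => z - y) μ) (-y) ∂μ ∂P) ∧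
      Filter.Tendsto (fun j : ℕ => groundStateEnergy lennardJones 3 (ψ (φ j)) / (ψ (φ j) : ℝ))
        Filter.atTop (nhds (∫ μ, (∫ y, lennardJones ‖y‖ ∂μ) / 2 ∂P)) ∧
      ∀ T : Set (Measure (EuclideanSpace ℝ (Fin 3))), ∀ R ε : ℝ, 0 < ε → ∀ ρ : ℝ, ρ < (P T).toReal →
        ∀ᶠ j : ℕ in Filter.atTop, ρ * (ψ (φ j) : ℝ) ≤ (Nat.card {i : Fin (ψ (φ j)) // ∃ ν ∈ T,
          ((∀ p : EuclideanSpace ℝ (Fin 3), ν {p} ≠ 0 → ‖p‖ ≤ R →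
              ∃ q ∈ (Set.range (fun k : Fin (ψ (φ j)) => x (ψ (φ j)) k - x (ψ (φ j)) i)), dist q p ≤ ε) ∧
            (∀ q ∈ (Set.range (fun k : Fin (ψ (φ j)) => x (ψ (φ j)) k - x (ψ (φ j)) i)), ‖q‖ ≤ R →
              ∃ p : EuclideanSpace ℝ (Fin 3), ν {p} ≠ 0 ∧ dist q p ≤ ε))} : ℝ) :=
  Summit.AtomisticToContinuum.Crystallization.Theorems.SquareWellLayerCakeTwelveWithinOne.stub_bsLimitAlong

/-- **STUB `stub_hcpCellCertificate` (L, certified numerics)** — THE LATTICE CONSTANT OF RELAXED hcp IS IN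
K2's BOND BOX WITH SLACK: there is `σ > 0` such that every global minimiser `(a, h)` of the total hcp energy
function `hcpE` over the open quadrant has its in-layer bond `a` and its interlayer bond `√(a²/3 + h²)` in
`[55/57 + σ, 1 − σ]`. Floats: minimiser `a = 0.971297`, `√(a²/3+h²) = 0.971206`, window `[0.964912, 1]`;
energy margin to the binding exit (`√(a²/3+h²) = 55/57` at `c = h/a ≈ 0.809`) `5.8·10⁻⁴`, to `a = 55/57`
`6.0·10⁻⁴`, to the expansion exits `≥ 9.7·10⁻³` (`compute/hcp_margin.py`). Method: shape reduction
`hcpE a (a c) = ½(a⁻¹² S₆(c)/12 − a⁻⁶ S₃(c)/6)` (`hcpE_eq_hcpSumS`), a global minimiser has `F(c) = S₃²/S₆`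
maximal and `a⁶ = S₆(c)/S₃(c)` (`hcpE_globalMin_shape`); certified `S₃, S₆` on a grid by the kernel
evaluator `hcpSumFloorSum` (`hcpSumS_ge_cert/le_cert`, cube `K ≈ 27` for `S₃`), antitone bracketing
between grid points (`hcpSumS_antitone`), exclusion of `c` with `F(c) < F(0.8164)`, then the valley bounds
on `a` and `a √(1/3 + c²)`. [folklore] -/
theorem stub_hcpCellCertificate :
    ∃ σ : ℝ, 0 < σ ∧ ∀ a h : ℝ, 0 < a → 0 < h →
      (∀ a' h' : ℝ, 0 < a' → 0 < h' → hcpE a h ≤ hcpE a' h') →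
      55 / 57 + σ ≤ a ∧ a ≤ 1 - σ ∧
        55 / 57 + σ ≤ Real.sqrt (a ^ 2 / 3 + h ^ 2) ∧ Real.sqrt (a ^ 2 / 3 + h ^ 2) ≤ 1 - σ :=
  Summit.AtomisticToContinuum.Crystallization.Theorems.SquareWellLayerCakeTwelveWithinOne.stub_hcpCellCertificate

/-- **STUB `stub_hcpRootGeometry` (S/M, pure hcp geometry)** — K2 WITH SLACK AT THE ROOT OF A ROTATED hcp
CRYSTAL: if `a` and `√(a²/3+h²)` lie in `[55/57 + σ, 1 − σ]` (`0 < σ ≤ 1/100`, `h > 0`) then in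
`count|A(hcpStacking a h)` every atom `w` with `‖w‖ ≤ 11/10 + σ` is `(55/57 + σ)`-separated from every other
atom (indeed ALL pairs are: the minimal distance of the hcp stacking is `min (a, √(a²/3+h²))` since
`2h > 1`), and the twelve first-shell sites of the root (`hcpStarIdx`: six at distance `a`, six at
`√(a²/3+h²)`) are atoms `w ≠ 0` with `‖w‖ ≤ 1 − σ`. [folklore] -/
theorem stub_hcpRootGeometry :
    ∀ σ a h : ℝ, 0 < σ → σ ≤ 1 / 100 →
      55 / 57 + σ ≤ a → a ≤ 1 - σ →
      55 / 57 + σ ≤ Real.sqrt (a ^ 2 / 3 + h ^ 2) → Real.sqrt (a ^ 2 / 3 + h ^ 2) ≤ 1 - σ → 0 < h →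
      ∀ A : EuclideanSpace ℝ (Fin 3) ≃ₗᵢ[ℝ] EuclideanSpace ℝ (Fin 3),
      (∀ w : EuclideanSpace ℝ (Fin 3),
          (Measure.count : Measure (EuclideanSpace ℝ (Fin 3))).restrict (A '' hcpStacking a h) {w} ≠ 0 →
          ‖w‖ ≤ 11 / 10 + σ →
          ∀ w' : EuclideanSpace ℝ (Fin 3),
            (Measure.count : Measure (EuclideanSpace ℝ (Fin 3))).restrict (A '' hcpStacking a h) {w'} ≠ 0 →
            w' ≠ w → 55 / 57 + σ ≤ dist w w') ∧
        ∃ T : Finset (EuclideanSpace ℝ (Fin 3)), T.card = 12 ∧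
          ∀ w ∈ T, (Measure.count : Measure (EuclideanSpace ℝ (Fin 3))).restrict (A '' hcpStacking a h) {w} ≠ 0 ∧
            w ≠ 0 ∧ ‖w‖ ≤ 1 - σ :=
  Summit.AtomisticToContinuum.Crystallization.Theorems.SquareWellLayerCakeTwelveWithinOne.stub_hcpRootGeometry

/-- **STUB `stub_return` (M)** — FROM MEASURE-LEVEL K2 WITH SLACK TO THE CRUX: if every minimising
point-stationary hard-core law satisfies `RootTwelveWithin σ` a.s. (`σ > 0`) and ground states have BS
limits along prescribed subsequences, then the crux's conclusion (stated UNFOLDED — only `TwelveWithinOne_of`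
may conclude the crux by name). Proof: were the bad fraction `≥ η > 0` along a
subsequence `ψ`, take the BS limit `P` along `ψ ∘ φ`; it is minimising (`E_P[h] = lim E(N)/N = e*`,
`crysEnergyLimit_proof`, `tendsto_nhds_unique`), so `P {RootTwelveWithin σ} = 1`; density transfer with
`R = 3`, `ε = min (σ, δ, 1/3)/3` makes, eventually, `≥ (1 − η/2)·N` particles `(R, ε)`-matched to such a
configuration, and each matched particle satisfies the UN-slackened predicate (twelve distinct particles
within `1 − σ + ε ≤ 1`, distinct by the hard core of `ν` and `ε < δ/2`, none equal to `x_i` since atoms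
`≠ 0` have norm `≥ δ > ε`; separation: two particles within `11/10` resp. `11/10 + 55/57 < 3` of `x_i` at
mutual distance `< 55/57` are matched to atoms at mutual distance `< 55/57 + 2ε ≤ 55/57 + σ`, hence to the
SAME atom, hence within `2ε < 1/3` of each other — impossible for distinct particles of a ground state,
`LennardJonesMinimalDistance_holds` / `third_le_dist_of_isGroundState`) — contradiction. [folklore] -/
theorem stub_return :
    ∀ σ : ℝ, 0 < σ →
    (∀ δ : ℝ, 0 < δ → ∀ P : Measure (Measure (EuclideanSpace ℝ (Fin 3))), IsProbabilityMeasure P →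
      (∀ᵐ μ ∂P, (∃ S : Set (EuclideanSpace ℝ (Fin 3)), (0 : EuclideanSpace ℝ (Fin 3)) ∈ S ∧
        (∀ x ∈ S, ∀ y ∈ S, x ≠ y → δ ≤ dist x y) ∧
        μ = (Measure.count : Measure (EuclideanSpace ℝ (Fin 3))).restrict S)) →
      (∀ g : Measure (EuclideanSpace ℝ (Fin 3)) → EuclideanSpace ℝ (Fin 3) → ℝ≥0∞,
        Measurable (Function.uncurry g) →
        ∫⁻ μ, ∫⁻ y, g μ y ∂μ ∂P = ∫⁻ μ, ∫⁻ y, g (Measure.map (fun z => z - y) μ) (-y) ∂μ ∂P) →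
      (∫ μ, (∫ y, lennardJones ‖y‖ ∂μ) / 2 ∂P) ≤
        (⨅ Q : PeriodicConfiguration 3, Q.energyPerParticle lennardJones) →
      ∀ᵐ μ ∂P,
        (∀ w : EuclideanSpace ℝ (Fin 3), μ {w} ≠ 0 → ‖w‖ ≤ 11 / 10 + σ →
            ∀ w' : EuclideanSpace ℝ (Fin 3), μ {w'} ≠ 0 → w' ≠ w → 55 / 57 + σ ≤ dist w w') ∧
          ∃ T : Finset (EuclideanSpace ℝ (Fin 3)), T.card = 12 ∧
            ∀ w ∈ T, μ {w} ≠ 0 ∧ w ≠ 0 ∧ ‖w‖ ≤ 1 - σ) →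
    (∀ x : (N : ℕ) → (Fin N → EuclideanSpace ℝ (Fin 3)), (∀ N, IsGroundState lennardJones (x N)) →
      ∀ ψ : ℕ → ℕ, StrictMono ψ →
      ∃ φ : ℕ → ℕ, StrictMono φ ∧ ∃ δ : ℝ, 0 < δ ∧
        ∃ P : Measure (Measure (EuclideanSpace ℝ (Fin 3))), IsProbabilityMeasure P ∧
        (∀ᵐ μ ∂P, (∃ S : Set (EuclideanSpace ℝ (Fin 3)), (0 : EuclideanSpace ℝ (Fin 3)) ∈ S ∧
          (∀ x ∈ S, ∀ y ∈ S, x ≠ y → δ ≤ dist x y) ∧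
          μ = (Measure.count : Measure (EuclideanSpace ℝ (Fin 3))).restrict S)) ∧
        (∀ g : Measure (EuclideanSpace ℝ (Fin 3)) → EuclideanSpace ℝ (Fin 3) → ℝ≥0∞,
          Measurable (Function.uncurry g) →
          ∫⁻ μ, ∫⁻ y, g μ y ∂μ ∂P = ∫⁻ μ, ∫⁻ y, g (Measure.map (fun z => z - y) μ) (-y) ∂μ ∂P) ∧
        Filter.Tendsto (fun j : ℕ => groundStateEnergy lennardJones 3 (ψ (φ j)) / (ψ (φ j) : ℝ))
          Filter.atTop (nhds (∫ μ, (∫ y, lennardJones ‖y‖ ∂μ) / 2 ∂P)) ∧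
        ∀ T : Set (Measure (EuclideanSpace ℝ (Fin 3))), ∀ R ε : ℝ, 0 < ε → ∀ ρ : ℝ, ρ < (P T).toReal →
          ∀ᶠ j : ℕ in Filter.atTop, ρ * (ψ (φ j) : ℝ) ≤ (Nat.card {i : Fin (ψ (φ j)) // ∃ ν ∈ T,
            ((∀ p : EuclideanSpace ℝ (Fin 3), ν {p} ≠ 0 → ‖p‖ ≤ R →
                ∃ q ∈ (Set.range (fun k : Fin (ψ (φ j)) => x (ψ (φ j)) k - x (ψ (φ j)) i)), dist q p ≤ ε) ∧
              (∀ q ∈ (Set.range (fun k : Fin (ψ (φ j)) => x (ψ (φ j)) k - x (ψ (φ j)) i)), ‖q‖ ≤ R →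
                ∃ p : EuclideanSpace ℝ (Fin 3), ν {p} ≠ 0 ∧ dist q p ≤ ε))} : ℝ)) →
    ∀ x : (N : ℕ) → (Fin N → EuclideanSpace ℝ (Fin 3)),
      (∀ N, IsGroundState lennardJones (x N)) →
      Filter.Tendsto (fun N : ℕ => (Nat.card {i : Fin N //
        ¬ ((∀ j : Fin N, dist (x N i) (x N j) ≤ 11 / 10 → ∀ k : Fin N, k ≠ j → (55 : ℝ) / 57 ≤ dist (x N j) (x N k)) ∧
          12 ≤ (Finset.univ.filter fun j : Fin N => j ≠ i ∧ dist (x N i) (x N j) ≤ 1).card)} : ℝ) / N)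
        Filter.atTop (nhds 0) :=
  Summit.AtomisticToContinuum.Crystallization.Theorems.SquareWellLayerCakeTwelveWithinOne.stub_return

/-! ## Glue (sorry-free) -/

/-- `e(hcp a h) = hcpE a h` (`a, h ≠ 0`): third clause of the landed series theorem
`hcpEnergySeries_of_eq`. [folklore] -/
theorem hcpE_eq_energyPerParticle {a h : ℝ} (ha : a ≠ 0) (hh : h ≠ 0) :
    hcpE a h = (hcpPeriodicConfiguration ha hh).energyPerParticle lennardJones :=
  ((hcpEnergySeries_of_eq a h ha hh hcpQ rfl).2.2).symm

/-- The target of route `PalmUnimodularRigidity` from the two open cruxes and the landed chart + glue.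
[folklore] -/
theorem palmRigidity_of_stubs (hShells : MinimiserShells) (hSelect : LayeredLawsSelectHcp) : PalmRigidity :=
  Summit.AtomisticToContinuum.Crystallization.Theorems.PalmUnimodularRigidity.cruxesToPalmRigidity_proof
    hShells
    Summit.AtomisticToContinuum.Crystallization.Cruxes.ShellsToBarlowChart.DevelopTheModelGrowthDescent.ShellsToBarlowChart_of
    hSelect

/-- **PINNING IS FREE.** If `e(hcp a h) = e*` then `(a, h)` is a global minimiser of `hcpE` over the open
quadrant (`e* ≤ e(hcp a' h') = hcpE a' h'`, `ciInf_le crysPeriodicBddBelow_proof`). [folklore] -/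
theorem hcpE_globalMin_of_energy_eq_eStar {a h : ℝ} (ha : a ≠ 0) (hh : h ≠ 0)
    (hE : (hcpPeriodicConfiguration ha hh).energyPerParticle lennardJones =
      ⨅ Q : PeriodicConfiguration 3, Q.energyPerParticle lennardJones) :
    ∀ a' h' : ℝ, 0 < a' → 0 < h' → hcpE a h ≤ hcpE a' h' := by
  intro a' h' ha' hh'
  rw [hcpE_eq_energyPerParticle ha hh, hE, hcpE_eq_energyPerParticle ha'.ne' hh'.ne']
  exact ciInf_le Summit.AtomisticToContinuum.Crystallization.Theorems.crysPeriodicBddBelow_proof _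

/-- **Measure-level K2 with slack, from the stubs** (sorry-free glue): `PalmRigidity` (from
`stub_minimiserShells`, `ShellsToBarlowChart_of`, `stub_layeredLawsSelectHcp`) makes a.e. sample of a
minimising law a rotated `hcp(a, h)` with `e(hcp a h) = e*`; pinning is free; the certificate puts the two
bond lengths in the box with slack `σ₀`; the root geometry gives `RootTwelveWithin (min σ₀ (1/100))`.
[folklore] -/
theorem minimisingLawsTwelveWithin_of_stubs (hShells : MinimiserShells) (hSelect : LayeredLawsSelectHcp)
    {σ₀ : ℝ} (hσ₀ : 0 < σ₀)
    (hCert : ∀ a h : ℝ, 0 < a → 0 < h →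
      (∀ a' h' : ℝ, 0 < a' → 0 < h' → hcpE a h ≤ hcpE a' h') →
      55 / 57 + σ₀ ≤ a ∧ a ≤ 1 - σ₀ ∧
        55 / 57 + σ₀ ≤ Real.sqrt (a ^ 2 / 3 + h ^ 2) ∧ Real.sqrt (a ^ 2 / 3 + h ^ 2) ≤ 1 - σ₀) :
    MinimisingLawsTwelveWithin (min σ₀ (1 / 100)) := by
  intro δ hδ P hP hcore hstat hmin
  have hPalm : PalmRigidity := palmRigidity_of_stubs hShells hSelect
  have hae := hPalm δ hδ P hP hcore hstat hmin
  filter_upwards [hae] with μ hμ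
  obtain ⟨a, h, ha, hh, ha1, -, hh1, -, A, hE, rfl⟩ := hμ
  have hapos : 0 < a := by linarith
  have hhpos : 0 < h := by linarith
  obtain ⟨hb1, hb2, hb3, hb4⟩ := hCert a h hapos hhpos (hcpE_globalMin_of_energy_eq_eStar ha hh hE)
  set σ := min σ₀ (1 / 100) with hσ_def
  have hσpos : 0 < σ := lt_min hσ₀ (by norm_num)
  have hσle : σ ≤ 1 / 100 := min_le_right _ _
  have hσle' : σ ≤ σ₀ := min_le_left _ _
  exact stub_hcpRootGeometry σ a h hσpos hσle (by linarith) (by linarith) (by linarith) (by linarith)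
    hhpos A

/-! ## Composition: the crux BY NAME (sorry-free outside the stubs) -/

/-- **SKELETON THEOREM — the crux `TwelveWithinOne` BY NAME from the registered stubs.** The two shared
cruxes 9225/9226 (as `stub_minimiserShells`, `stub_layeredLawsSelectHcp`), the certificate and the root
geometry give measure-level K2 with slack `σ = min σ₀ (1/100) > 0`; `stub_return` and `stub_bsLimitAlong`
return it to every sequence of ground states. -/
theorem TwelveWithinOne_of :
    Summit.AtomisticToContinuum.Crystallization.Theses.SquareWellLayerCake.TwelveWithinOne := by
  obtain ⟨σ₀, hσ₀, hCert⟩ := stub_hcpCellCertificate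
  have hLaws := minimisingLawsTwelveWithin_of_stubs stub_minimiserShells stub_layeredLawsSelectHcp hσ₀ hCert
  unfold Summit.AtomisticToContinuum.Crystallization.Theses.SquareWellLayerCake.TwelveWithinOne
  exact stub_return (min σ₀ (1 / 100)) (lt_min hσ₀ (by norm_num)) hLaws stub_bsLimitAlong

/-! ## Read-backs (definitional sanity) -/

/-- `stub_return`'s first hypothesis is `MinimisingLawsTwelveWithin σ` verbatim. [folklore] -/
example (σ : ℝ) (h : MinimisingLawsTwelveWithin σ) :
    ∀ δ : ℝ, 0 < δ → ∀ P : Measure (Measure (EuclideanSpace ℝ (Fin 3))), IsProbabilityMeasure P →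
      (∀ᵐ μ ∂P, (∃ S : Set (EuclideanSpace ℝ (Fin 3)), (0 : EuclideanSpace ℝ (Fin 3)) ∈ S ∧
        (∀ x ∈ S, ∀ y ∈ S, x ≠ y → δ ≤ dist x y) ∧
        μ = (Measure.count : Measure (EuclideanSpace ℝ (Fin 3))).restrict S)) →
      (∀ g : Measure (EuclideanSpace ℝ (Fin 3)) → EuclideanSpace ℝ (Fin 3) → ℝ≥0∞,
        Measurable (Function.uncurry g) →
        ∫⁻ μ, ∫⁻ y, g μ y ∂μ ∂P = ∫⁻ μ, ∫⁻ y, g (Measure.map (fun z => z - y) μ) (-y) ∂μ ∂P) →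
      (∫ μ, (∫ y, lennardJones ‖y‖ ∂μ) / 2 ∂P) ≤
        (⨅ Q : PeriodicConfiguration 3, Q.energyPerParticle lennardJones) →
      ∀ᵐ μ ∂P, RootTwelveWithin σ μ := h

end Summit.AtomisticToContinuum.Crystallization.Cruxes.TwelveWithinOne.Sketch

end
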